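import Literature.Analysis.FluidPDE.TaoQuantitativeSymbolBounds
import Literature.Analysis.FluidPDE.KochTataruKernelFourier
import Literature.Analysis.FluidPDE.OseenKernelBlocks
import Literature.Analysis.FunctionSpaces.LittlewoodPaleySquareFunction
import Mathlib.Analysis.Fourier.Convolution
import Mathlib.Analysis.Fourier.Inversion
import HarnessLib

/-!
# Tao 2021, (2.4)/Lemma 2.1 for `P_N e^{τΔ} ℙ∇·`: pointwise decay of the blocked Oseen kernel

Analysis/FluidPDE proof file (theorems only, no named facts), step 8d-2 of the inline programme
for `Literature.Analysis.FluidPDE.tao_quantitative_ess` (Tao 2021, Thm. 1.2).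

T. Tao, arXiv:1908.04958v2, §2 p. 8: the operators `P_N e^{tΔ}∇ʲ` obey (2.4)
"`‖P_N e^{tΔ} ∇ʲ f‖_{L^q} ≲ⱼ exp(−N²t/20) N^{j+3/p−3/q} ‖f‖_{L^p}`", in the same spirit as
Lemma 2.1, whose proof provides the kernel bound "`K(x) ≲ (1 + |x|)^{-90}` (say)" at unit
frequency scale. In Prop. 3.1 (iv) these bounds are applied (in the local form (2.2)) to
`P_N e^{(t−t')Δ} ℙ∇·`, i.e. — in the kernel language of the tree — to the Littlewood–Paley blocks
`Δ̇_j K(τ, ·)[a, b]` of the Oseen–Koch–Tataru kernel (`oseenKernel`, the kernel of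
`e^{τΔ}ℙ∇·` on rank-one tensors). This file proves the **pointwise decay of the blocked Oseen
kernel** with the heat gain and the frequency scaling of (2.4):

* `fourier_blockFn_inner_oseenKernel` — the symbol: `𝓕(Δ̇_j⟨K(τ,·)[a,b], w⟩)(ξ) =
  φ_j(ξ) · 2πi⟨ξ,a⟩ e^{-(2π)²τ‖ξ‖²}(⟨b,w⟩ − ⟨ξ,b⟩⟨ξ,w⟩/‖ξ‖²)` (convolution theorem and
  `fourier_inner_oseenKernel`);
* `blockFn_inner_oseenKernel_eq_fourierInv` — Fourier inversion for the (continuous, integrable)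
  blocked component;
* `blockedOseenSymbol_eq_dilate` — the symbol is `2^j m₁(2^{-j}ξ)` with the unit-scale symbol
  `m₁ = φ₀ S e^{-s‖·‖²}`, `s = (2π)²τ4^j`, of `TaoQuantitativeSymbolBounds.lean`;
* `exists_norm_blockFn_inner_oseenKernel_le` — **for every `n` there is `C` with
  `|Δ̇_j⟨K(τ,·)[a,b], w⟩(x)| ≤ C 2^{(d+1)j} e^{-τ4^j} (1 + 2^j‖x‖)^{-n}`** for all `j ∈ ℤ`,
  `τ > 0`, `x` (`d = dim E`);
* `exists_sum_norm_blockFn_oseenKernel_le` — the same for the scalar majorant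
  `∑_{k,l} ‖Δ̇_j K(τ,·)[e_k,e_l](x)‖` of the blocked kernel matrix used by the slice estimates
  (`eLpNorm_blockFn_oseenSlice_le`, `BesovDuhamelBlocks.lean`).

## References

* T. Tao, arXiv:1908.04958v2 (2021), Lemma 2.1 (proof p. 8), (2.4) p. 8. [Tao2021QuantitativeNS]
* S. Palasek, ARMA 242 (2021), §2 ("(PNheat)", "(localbernstein)"). [Palasek2021]
* H. Koch, D. Tataru, Adv. Math. 157 (2001), §2 (6)–(8) (the symbol of `ℙ∇e^{τΔ}`).
  [KochTataruAdvMath2001]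
-/

noncomputable section

open MeasureTheory Set Function Filter Topology Metric Module
open scoped ENNReal NNReal FourierTransform Real ContDiff RealInnerProductSpace Convolution SchwartzMap

namespace Literature.Analysis.FluidPDE

open Literature.Analysis.Fourier (cgauss)
open Literature.Analysis.FunctionSpaces (blockFn blockKernel blockKernelC dyadicSymbol
  dyadicSymbolSchwartz)
open UnboundedOperators (heatSymbol)

variable {E : Type*} [NormedAddCommGroup E] [InnerProductSpace ℝ E] [FiniteDimensional ℝ E]
  [MeasurableSpace E] [BorelSpace E]

/-! ## Generalities: continuity of blocks of integrable fields, linearity of `𝓕⁻` -/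

/-- The block `Δ̇_j f = K_j ⋆ f` of an integrable field is continuous (`K_j` is bounded and
continuous). [folklore] -/
theorem continuous_blockFn_of_integrable (j : ℤ) {F' : Type*} [NormedAddCommGroup F']
    [NormedSpace ℝ F'] {f : E → F'} (hf : Integrable f) : Continuous (blockFn j f) := by
  obtain ⟨C, hC⟩ := FunctionSpaces.exists_norm_blockKernel_le (E := E) j
  have hbdd : BddAbove (range fun x => ‖blockKernel E j x‖) :=
    ⟨C, by rintro _ ⟨x, rfl⟩; exact hC x⟩
  exact hbdd.continuous_convolution_left_of_integrable (ContinuousLinearMap.lsmul ℝ ℝ)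
    (FunctionSpaces.continuous_blockKernel j) hf

/-- `𝓕⁻(c g)(x) = c 𝓕⁻g(x)`. [folklore] -/
theorem fourierInv_const_mul (c : ℂ) (g : E → ℂ) (x : E) :
    𝓕⁻ (fun ξ => c * g ξ) x = c * 𝓕⁻ g x := by
  simp only [Real.fourierInv_eq, Circle.smul_def, smul_eq_mul]
  rw [← integral_const_mul]
  congr 1
  funext v
  ring

omit [FiniteDimensional ℝ E] [MeasurableSpace E] [BorelSpace E] in
/-- `‖v‖ ≤ ∑ᵢ |⟨v, eᵢ⟩|` for an orthonormal basis `e`. [folklore] -/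
private theorem norm_le_sum_abs_inner_right {ι : Type*} [Fintype ι] (e : OrthonormalBasis ι ℝ E)
    (v : E) :
    ‖v‖ ≤ ∑ i, |⟪v, e i⟫| := by
  calc ‖v‖ = ‖∑ i, ⟪e i, v⟫ • e i‖ := by rw [e.sum_repr' v]
    _ ≤ ∑ i, ‖⟪e i, v⟫ • e i‖ := norm_sum_le _ _
    _ = ∑ i, |⟪v, e i⟫| := by
        refine Finset.sum_congr rfl fun i _ => ?_
        rw [norm_smul, e.norm_eq_one, mul_one, Real.norm_eq_abs, real_inner_comm]

/-! ## The symbol of the blocked Oseen kernel -/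

/-- **The symbol of the blocked Oseen kernel** (convolution theorem `𝓕(h_j ⋆ f) = φ_j 𝓕f` and
`fourier_inner_oseenKernel`): for `τ > 0`,
`𝓕(Δ̇_j⟨K(τ,·)[a,b], w⟩)(ξ) = φ_j(ξ) 2πi⟨ξ,a⟩ e^{-(2π)²τ‖ξ‖²}(⟨b,w⟩ − ⟨ξ,b⟩⟨ξ,w⟩/‖ξ‖²)`.
[cite: Tao2021QuantitativeNS, (2.4) p. 8] -/
theorem fourier_blockFn_inner_oseenKernel {τ : ℝ} (hτ : 0 < τ) (j : ℤ) (a b w ξ : E) :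
    𝓕 (blockFn j (fun z : E => ((⟪oseenKernel τ z a b, w⟫ : ℝ) : ℂ))) ξ =
      dyadicSymbol j ξ * (2 * π * Complex.I * (⟪ξ, a⟫ : ℝ) * (heatSymbol τ ξ : ℝ) *
        ((⟪b, w⟫ - ⟪ξ, b⟫ * ⟪ξ, w⟫ / ‖ξ‖ ^ 2 : ℝ) : ℂ)) := by
  have hf := integrable_inner_oseenKernel hτ a b w
  have hK : Integrable ((blockKernelC E j : 𝓢(E, ℂ)) : E → ℂ) := (blockKernelC E j).integrable
  rw [← FunctionSpaces.blockKernelC_convolution_eq_blockFn j, Real.fourier_smul_convolution_eq hK hf ξ,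
    fourier_inner_oseenKernel hτ a b w ξ, smul_eq_mul]
  congr 1
  have h1 : 𝓕 ((blockKernelC E j : 𝓢(E, ℂ)) : E → ℂ) =
      ((𝓕 (blockKernelC E j) : 𝓢(E, ℂ)) : E → ℂ) := (SchwartzMap.fourier_coe _).symm
  rw [h1, FunctionSpaces.blockKernelC, FourierTransform.fourier_fourierInv_eq,
    FunctionSpaces.coe_dyadicSymbolSchwartz]

/-- The blocked component is integrable. [folklore] -/
theorem integrable_blockFn_inner_oseenKernel {τ : ℝ} (hτ : 0 < τ) (j : ℤ) (a b w : E) :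
    Integrable (blockFn j (fun z : E => ((⟪oseenKernel τ z a b, w⟫ : ℝ) : ℂ))) :=
  memLp_one_iff_integrable.1 (FunctionSpaces.memLp_blockFn j
    (memLp_one_iff_integrable.2 (integrable_inner_oseenKernel hτ a b w)) le_rfl)

/-- The symbol of the blocked component is integrable (bounded by `2‖f‖_{L¹}`, supported in
`‖ξ‖ ≤ 2^{j+1}`). [folklore] -/
theorem integrable_fourier_blockFn_inner_oseenKernel {τ : ℝ} (hτ : 0 < τ) (j : ℤ) (a b w : E) :
    Integrable (𝓕 (blockFn j (fun z : E => ((⟪oseenKernel τ z a b, w⟫ : ℝ) : ℂ)))) := by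
  have hf := integrable_inner_oseenKernel hτ a b w
  have hF := integrable_blockFn_inner_oseenKernel hτ j a b w
  have hcont : Continuous (𝓕 (blockFn j (fun z : E => ((⟪oseenKernel τ z a b, w⟫ : ℝ) : ℂ)))) :=
    VectorFourier.fourierIntegral_continuous Real.continuous_fourierChar
      (innerSL ℝ).continuous₂ hF
  obtain ⟨I, hI⟩ : ∃ I : ℝ, I = ∫ z, ‖((⟪oseenKernel τ z a b, w⟫ : ℝ) : ℂ)‖ := ⟨_, rfl⟩
  have hI0 : 0 ≤ I := by rw [hI]; exact integral_nonneg fun _ => norm_nonneg _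
  have hfou : ∀ ξ : E, ‖𝓕 (fun z : E => ((⟪oseenKernel τ z a b, w⟫ : ℝ) : ℂ)) ξ‖ ≤ I := fun ξ => by
    rw [hI, show 𝓕 (fun z : E => ((⟪oseenKernel τ z a b, w⟫ : ℝ) : ℂ)) ξ =
      VectorFourier.fourierIntegral 𝐞 volume (innerₗ E)
        (fun z : E => ((⟪oseenKernel τ z a b, w⟫ : ℝ) : ℂ)) ξ from rfl]
    exact VectorFourier.norm_fourierIntegral_le_integral_norm _ _ _ _ _
  have hbound : ∀ ξ : E, ‖𝓕 (blockFn j (fun z : E => ((⟪oseenKernel τ z a b, w⟫ : ℝ) : ℂ))) ξ‖ ≤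
      (closedBall (0 : E) ((2 : ℝ) ^ (j + 1))).indicator (fun _ => 2 * I) ξ := by
    intro ξ
    rw [fourier_blockFn_inner_oseenKernel hτ j a b w ξ, ← fourier_inner_oseenKernel hτ a b w ξ]
    by_cases hξ : ξ ∈ closedBall (0 : E) ((2 : ℝ) ^ (j + 1))
    · rw [indicator_of_mem hξ, norm_mul]
      exact mul_le_mul (FunctionSpaces.norm_dyadicSymbol_le_two j ξ) (hfou ξ) (norm_nonneg _)
        zero_le_two
    · rw [indicator_of_notMem hξ]
      rw [mem_closedBall_zero_iff, not_le] at hξ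
      rw [FunctionSpaces.dyadicSymbol_apply_of_le_norm_holds hξ.le, zero_mul, norm_zero]
  have hg : Integrable ((closedBall (0 : E) ((2 : ℝ) ^ (j + 1))).indicator fun _ => 2 * I) := by
    rw [integrable_indicator_iff measurableSet_closedBall]
    exact integrableOn_const measure_closedBall_lt_top.ne
  exact hg.mono' hcont.aestronglyMeasurable (Eventually.of_forall hbound)

/-- **Fourier inversion for the blocked component**: for `τ > 0` and every `x`,
`Δ̇_j⟨K(τ,·)[a,b], w⟩(x) = 𝓕⁻(φ_j · 2πi⟨·,a⟩e^{-(2π)²τ‖·‖²}(⟨b,w⟩ − ⟨·,b⟩⟨·,w⟩/‖·‖²))(x)`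
(the block is continuous and integrable with integrable transform). [cite: Tao2021QuantitativeNS, Lemma 2.1 proof p. 8] -/
theorem blockFn_inner_oseenKernel_eq_fourierInv {τ : ℝ} (hτ : 0 < τ) (j : ℤ) (a b w x : E) :
    blockFn j (fun z : E => ((⟪oseenKernel τ z a b, w⟫ : ℝ) : ℂ)) x =
      𝓕⁻ (fun ξ : E => dyadicSymbol j ξ * (2 * π * Complex.I * (⟪ξ, a⟫ : ℝ) *
        (heatSymbol τ ξ : ℝ) * ((⟪b, w⟫ - ⟪ξ, b⟫ * ⟪ξ, w⟫ / ‖ξ‖ ^ 2 : ℝ) : ℂ))) x := by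
  have hcont : Continuous (blockFn j (fun z : E => ((⟪oseenKernel τ z a b, w⟫ : ℝ) : ℂ))) :=
    continuous_blockFn_of_integrable j (integrable_inner_oseenKernel hτ a b w)
  have h := congrFun (hcont.fourierInv_fourier_eq (integrable_blockFn_inner_oseenKernel hτ j a b w)
    (integrable_fourier_blockFn_inner_oseenKernel hτ j a b w)) x
  have hm : 𝓕 (blockFn j (fun z : E => ((⟪oseenKernel τ z a b, w⟫ : ℝ) : ℂ))) =
      fun ξ : E => dyadicSymbol j ξ * (2 * π * Complex.I * (⟪ξ, a⟫ : ℝ) *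
        (heatSymbol τ ξ : ℝ) * ((⟪b, w⟫ - ⟪ξ, b⟫ * ⟪ξ, w⟫ / ‖ξ‖ ^ 2 : ℝ) : ℂ)) :=
    funext (fourier_blockFn_inner_oseenKernel hτ j a b w)
  rw [← h, hm]

/-! ## Scaling to unit frequency -/

omit [FiniteDimensional ℝ E] [MeasurableSpace E] [BorelSpace E] in
/-- **The blocked Oseen symbol is a dilate of a unit-scale annular symbol**:
`φ_j(ξ) 2πi⟨ξ,a⟩ e^{-(2π)²τ‖ξ‖²} R(ξ) = 2^j m₁(2^{-j}ξ)` with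
`m₁(η) = φ₀(η) · 2πi⟨η,a⟩R(η) · e^{-s‖η‖²}`, `s = (2π)²τ(2^j)²`, `R` the (0-homogeneous) Leray
factor `⟨b,w⟩ − ⟨η,b⟩⟨η,w⟩/‖η‖²` ("by scaling we may normalise `N = 1`"). [cite: Tao2021QuantitativeNS, Lemma 2.1 proof p. 8] -/
theorem blockedOseenSymbol_eq_dilate (τ : ℝ) (j : ℤ) (a b w ξ : E) :
    dyadicSymbol j ξ * (2 * π * Complex.I * (⟪ξ, a⟫ : ℝ) * (heatSymbol τ ξ : ℝ) *
        ((⟪b, w⟫ - ⟪ξ, b⟫ * ⟪ξ, w⟫ / ‖ξ‖ ^ 2 : ℝ) : ℂ)) =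
      (((2 : ℝ) ^ j : ℝ) : ℂ) *
        (dyadicSymbol 0 ((((2 : ℝ) ^ j)⁻¹) • ξ) *
          (2 * π * Complex.I * (((⟪(((2 : ℝ) ^ j)⁻¹) • ξ, a⟫ *
            (⟪b, w⟫ - ⟪(((2 : ℝ) ^ j)⁻¹) • ξ, b⟫ * ⟪(((2 : ℝ) ^ j)⁻¹) • ξ, w⟫ /
              ‖(((2 : ℝ) ^ j)⁻¹) • ξ‖ ^ 2)) : ℝ) : ℂ)) *
          cgauss ((2 * π) ^ 2 * τ * ((2 : ℝ) ^ j) ^ 2) ((((2 : ℝ) ^ j)⁻¹) • ξ)) := by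
  obtain ⟨N, hN⟩ : ∃ N : ℝ, N = (2 : ℝ) ^ j := ⟨_, rfl⟩
  have hN0 : 0 < N := by rw [hN]; exact zpow_pos two_pos _
  obtain ⟨c, hc⟩ : ∃ c : ℝ, c = N⁻¹ := ⟨_, rfl⟩
  have hc0 : 0 < c := by rw [hc]; exact inv_pos.2 hN0
  have hNc : N * c = 1 := by rw [hc]; exact mul_inv_cancel₀ hN0.ne'
  rw [← hN, ← hc]
  -- the four factors
  have hφ : dyadicSymbol j ξ = dyadicSymbol 0 (c • ξ) := by
    rw [FunctionSpaces.dyadicSymbol_eq_dyadicSymbol_zero_smul j ξ, zpow_neg, ← hN, ← hc]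
  have hinner : ⟪c • ξ, a⟫ = c * ⟪ξ, a⟫ := real_inner_smul_left _ _ _
  have hratio : ⟪b, w⟫ - ⟪c • ξ, b⟫ * ⟪c • ξ, w⟫ / ‖c • ξ‖ ^ 2 =
      ⟪b, w⟫ - ⟪ξ, b⟫ * ⟪ξ, w⟫ / ‖ξ‖ ^ 2 := by
    rw [real_inner_smul_left, real_inner_smul_left, norm_smul, Real.norm_of_nonneg hc0.le, mul_pow,
      show c * ⟪ξ, b⟫ * (c * ⟪ξ, w⟫) = c ^ 2 * (⟪ξ, b⟫ * ⟪ξ, w⟫) by ring,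
      mul_div_mul_left _ _ (pow_ne_zero 2 hc0.ne')]
  have hgauss : cgauss ((2 * π) ^ 2 * τ * N ^ 2) (c • ξ) = ((heatSymbol τ ξ : ℝ) : ℂ) := by
    rw [Fourier.cgauss_eq, UnboundedOperators.heatSymbol]
    simp only
    congr 2
    rw [norm_smul, Real.norm_of_nonneg hc0.le]
    linear_combination (-(2 * π) ^ 2 * τ * ‖ξ‖ ^ 2 * (N * c + 1)) * hNc
  rw [hφ, hinner, hratio, hgauss]
  have hNcC : ((N : ℝ) : ℂ) * ((c : ℝ) : ℂ) = 1 := by exact_mod_cast hNc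
  push_cast
  linear_combination (-(dyadicSymbol 0 (c • ξ) * (2 * ↑π * Complex.I) * (⟪ξ, a⟫ : ℂ) *
    ((⟪b, w⟫ : ℂ) - (⟪ξ, b⟫ : ℂ) * (⟪ξ, w⟫ : ℂ) / (‖ξ‖ : ℂ) ^ 2) * (heatSymbol τ ξ : ℂ))) * hNcC

omit [FiniteDimensional ℝ E] [MeasurableSpace E] [BorelSpace E] in
/-- `2^j (2^j)^d = 2^{(d+1)j}`. [folklore] -/
theorem two_zpow_mul_pow_finrank (j : ℤ) (d : ℕ) :
    (2 : ℝ) ^ j * ((2 : ℝ) ^ j) ^ d = (2 : ℝ) ^ (((d : ℤ) + 1) * j) := by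
  rw [← zpow_natCast, ← zpow_mul, ← zpow_add₀ (two_ne_zero' ℝ)]
  congr 1
  ring

omit [FiniteDimensional ℝ E] [MeasurableSpace E] [BorelSpace E] in
/-- The heat gain: `e^{-(2π)²τ(2^j)²/8} ≤ e^{-τ2^{2j}}` (`π² ≥ 2`). [folklore] -/
theorem exp_neg_heat_gain_le (τ : ℝ) (hτ : 0 ≤ τ) (j : ℤ) :
    Real.exp (-((2 * π) ^ 2 * τ * ((2 : ℝ) ^ j) ^ 2 / 8)) ≤ Real.exp (-(τ * 2 ^ (2 * j))) := by
  rw [Real.exp_le_exp]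
  have hsq : ((2 : ℝ) ^ j) ^ 2 = (2 : ℝ) ^ (2 * j) := by
    rw [← zpow_natCast, ← zpow_mul]; congr 1; ring
  rw [hsq]
  have hπ : (2 : ℝ) ≤ (2 * π) ^ 2 / 8 := by nlinarith [Real.pi_gt_three]
  have hτN : 0 ≤ τ * (2 : ℝ) ^ (2 * j) := mul_nonneg hτ (zpow_nonneg zero_le_two _)
  nlinarith

/-! ## The pointwise decay -/

/-- **Tao 2021, (2.4)/Lemma 2.1 for `P_N e^{τΔ}ℙ∇·`, pointwise kernel form.** For `a, b, w ∈ E`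
and `n ∈ ℕ` there is `C ≥ 0` such that for every `j ∈ ℤ`, `τ > 0` and `x ∈ E`:
`|Δ̇_j⟨K(τ,·)[a,b], w⟩(x)| ≤ C 2^{(d+1)j} e^{-τ 2^{2j}} (1 + 2^j‖x‖)^{-n}` (`d = dim E`): the
kernel of the frequency-`2^j` piece of `e^{τΔ}ℙ∇·` has size `N^{d+1}`, heat decay `e^{-N²τ}` and
is rapidly decreasing beyond the scale `N^{-1}` ("`K(x) ≲ (1+|x|)^{-90}`" after normalising
`N = 1`). [cite: Tao2021QuantitativeNS, Lemma 2.1 proof p. 8 and (2.4) p. 8] -/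
theorem exists_norm_blockFn_inner_oseenKernel_le (a b w : E) (n : ℕ) :
    ∃ C : ℝ, 0 ≤ C ∧ ∀ (j : ℤ) {τ : ℝ}, 0 < τ → ∀ x : E,
      ‖blockFn j (fun z : E => ((⟪oseenKernel τ z a b, w⟫ : ℝ) : ℂ)) x‖ ≤
        C * (2 : ℝ) ^ (((finrank ℝ E : ℤ) + 1) * j) * Real.exp (-(τ * 2 ^ (2 * j))) /
          (1 + (2 : ℝ) ^ j * ‖x‖) ^ n := by
  obtain ⟨C, hC0, hC⟩ := exists_norm_fourierInv_annularGauss_le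
    (contDiffOn_oseenSymbolComponent a b w) n
  refine ⟨C, hC0, fun j τ hτ x => ?_⟩
  obtain ⟨N, hN⟩ : ∃ N : ℝ, N = (2 : ℝ) ^ j := ⟨_, rfl⟩
  have hN0 : 0 < N := by rw [hN]; exact zpow_pos two_pos _
  obtain ⟨s, hs⟩ : ∃ s : ℝ, s = (2 * π) ^ 2 * τ * N ^ 2 := ⟨_, rfl⟩
  have hs0 : 0 ≤ s := by rw [hs]; positivity
  obtain ⟨-, -, -, hdecay⟩ := hC hs0
  -- the unit-scale symbol
  obtain ⟨m₁, hm₁⟩ : ∃ m₁ : E → ℂ, m₁ = fun η => dyadicSymbol 0 η *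
      (2 * π * Complex.I * (((⟪η, a⟫ * (⟪b, w⟫ - ⟪η, b⟫ * ⟪η, w⟫ / ‖η‖ ^ 2)) : ℝ) : ℂ)) *
      cgauss s η := ⟨_, rfl⟩
  -- the block as a dilated inverse Fourier transform
  have hrepr : blockFn j (fun z : E => ((⟪oseenKernel τ z a b, w⟫ : ℝ) : ℂ)) x =
      ((N : ℝ) : ℂ) * (((N ^ finrank ℝ E : ℝ) : ℂ) * 𝓕⁻ m₁ (N • x)) := by
    rw [blockFn_inner_oseenKernel_eq_fourierInv hτ j a b w x]
    have hfun : (fun ξ : E => dyadicSymbol j ξ * (2 * π * Complex.I * (⟪ξ, a⟫ : ℝ) *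
        (heatSymbol τ ξ : ℝ) * ((⟪b, w⟫ - ⟪ξ, b⟫ * ⟪ξ, w⟫ / ‖ξ‖ ^ 2 : ℝ) : ℂ))) =
        fun ξ => ((N : ℝ) : ℂ) * m₁ (N⁻¹ • ξ) := by
      funext ξ
      rw [blockedOseenSymbol_eq_dilate τ j a b w ξ, hm₁, ← hN, ← hs]
    rw [hfun, fourierInv_const_mul, fourierInv_dilate_apply m₁ hN0 x]
  -- the decay of the unit-scale kernel at the point `N • x`
  have hy := hdecay (N • x)
  rw [← hm₁, norm_smul, Real.norm_of_nonneg hN0.le] at hy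
  have hD : 0 < (1 + N * ‖x‖) ^ n := pow_pos (by positivity) _
  rw [le_div_iff₀ (by rw [← hN]; exact hD), hrepr, norm_mul, norm_mul, Complex.norm_real,
    Complex.norm_real, Real.norm_of_nonneg hN0.le, Real.norm_of_nonneg (pow_nonneg hN0.le _), ← hN]
  have hgain : Real.exp (-(s / 8)) ≤ Real.exp (-(τ * 2 ^ (2 * j))) := by
    rw [hs, hN]; exact exp_neg_heat_gain_le τ hτ.le j
  calc N * (N ^ finrank ℝ E * ‖𝓕⁻ m₁ (N • x)‖) * (1 + N * ‖x‖) ^ n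
      = N * N ^ finrank ℝ E * (‖𝓕⁻ m₁ (N • x)‖ * (1 + N * ‖x‖) ^ n) := by ring
    _ ≤ N * N ^ finrank ℝ E * (C * Real.exp (-(s / 8))) := by gcongr
    _ ≤ N * N ^ finrank ℝ E * (C * Real.exp (-(τ * 2 ^ (2 * j)))) := by gcongr
    _ = C * (2 : ℝ) ^ (((finrank ℝ E : ℤ) + 1) * j) * Real.exp (-(τ * 2 ^ (2 * j))) := by
        rw [hN, two_zpow_mul_pow_finrank]; ring

/-- The real blocked component: `⟨Δ̇_j K(τ,·)[a,b](x), w⟩ = Δ̇_j⟨K(τ,·)[a,b], w⟩(x)` (blocks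
commute with constant linear maps), so that `|⟨Δ̇_j K(τ,·)[a,b](x), w⟩|` is the norm of the
complexified blocked component. [folklore] -/
theorem abs_inner_blockFn_oseenKernel_eq {τ : ℝ} (hτ : 0 < τ) (j : ℤ) (a b w x : E) :
    |⟪blockFn j (fun z : E => oseenKernel τ z a b) x, w⟫| =
      ‖blockFn j (fun z : E => ((⟪oseenKernel τ z a b, w⟫ : ℝ) : ℂ)) x‖ := by
  haveI : Fact ((1 : ℝ≥0∞) ≤ 1) := ⟨le_rfl⟩
  have hmem : MemLp (fun z : E => oseenKernel τ z a b) 1 volume :=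
    memLp_one_iff_integrable.2 (integrable_oseenKernel_left_slice hτ a b)
  have h := FunctionSpaces.blockFn_comp_clm j (Complex.ofRealCLM.comp (innerSL ℝ w)) hmem
  have hfun : (fun z : E => ((⟪oseenKernel τ z a b, w⟫ : ℝ) : ℂ)) =
      fun z => (Complex.ofRealCLM.comp (innerSL ℝ w)) (oseenKernel τ z a b) := by
    funext z
    simp only [ContinuousLinearMap.coe_comp, Function.comp_apply, innerSL_apply_apply,
      Complex.ofRealCLM_apply, real_inner_comm w]
  rw [hfun, h]
  simp only [ContinuousLinearMap.coe_comp, Function.comp_apply, innerSL_apply_apply,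
    Complex.ofRealCLM_apply, Complex.norm_real, Real.norm_eq_abs, real_inner_comm w]

/-- **The scalar majorant of the blocked Oseen kernel matrix decays** (Tao 2021, (2.4) for
`P_N e^{τΔ}ℙ∇·`, kernel form): for every `n` there is `C ≥ 0` such that for all `j ∈ ℤ`, `τ > 0`,
`x ∈ E`, with `e` the standard orthonormal basis of `E` and `d = dim E`:
`∑_{k,l} ‖Δ̇_j K(τ,·)[e_k,e_l](x)‖ ≤ C 2^{(d+1)j} e^{-τ2^{2j}} (1 + 2^j‖x‖)^{-n}`.
[cite: Tao2021QuantitativeNS, (2.4) p. 8 and Lemma 2.1 proof p. 8] -/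
theorem exists_sum_norm_blockFn_oseenKernel_le (n : ℕ) :
    ∃ C : ℝ, 0 ≤ C ∧ ∀ (j : ℤ) {τ : ℝ}, 0 < τ → ∀ x : E,
      ∑ k, ∑ l, ‖blockFn j (fun z : E => oseenKernel τ z (stdOrthonormalBasis ℝ E k)
          (stdOrthonormalBasis ℝ E l)) x‖ ≤
        C * (2 : ℝ) ^ (((finrank ℝ E : ℤ) + 1) * j) * Real.exp (-(τ * 2 ^ (2 * j))) /
          (1 + (2 : ℝ) ^ j * ‖x‖) ^ n := by
  have h := fun k l i => exists_norm_blockFn_inner_oseenKernel_le (stdOrthonormalBasis ℝ E k)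
    (stdOrthonormalBasis ℝ E l) (stdOrthonormalBasis ℝ E i) n
  choose C hC0 hC using h
  refine ⟨∑ k, ∑ l, ∑ i, C k l i, Finset.sum_nonneg fun k _ => Finset.sum_nonneg fun l _ =>
    Finset.sum_nonneg fun i _ => hC0 k l i, fun j τ hτ x => ?_⟩
  obtain ⟨W, hW⟩ : ∃ W : ℝ, W = (2 : ℝ) ^ (((finrank ℝ E : ℤ) + 1) * j) *
      Real.exp (-(τ * 2 ^ (2 * j))) / (1 + (2 : ℝ) ^ j * ‖x‖) ^ n := ⟨_, rfl⟩
  have hCW : ∀ k l i, ‖blockFn j (fun z : E => ((⟪oseenKernel τ z (stdOrthonormalBasis ℝ E k)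
      (stdOrthonormalBasis ℝ E l), stdOrthonormalBasis ℝ E i⟫ : ℝ) : ℂ)) x‖ ≤ C k l i * W := by
    intro k l i
    rw [hW, ← mul_div_assoc, ← mul_assoc]
    exact hC k l i j hτ x
  calc ∑ k, ∑ l, ‖blockFn j (fun z : E => oseenKernel τ z (stdOrthonormalBasis ℝ E k)
          (stdOrthonormalBasis ℝ E l)) x‖
      ≤ ∑ k, ∑ l, ∑ i, |⟪blockFn j (fun z : E => oseenKernel τ z (stdOrthonormalBasis ℝ E k)
          (stdOrthonormalBasis ℝ E l)) x, stdOrthonormalBasis ℝ E i⟫| :=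
        Finset.sum_le_sum fun k _ => Finset.sum_le_sum fun l _ =>
          norm_le_sum_abs_inner_right (stdOrthonormalBasis ℝ E) _
    _ ≤ ∑ k, ∑ l, ∑ i, C k l i * W := by
        refine Finset.sum_le_sum fun k _ => Finset.sum_le_sum fun l _ =>
          Finset.sum_le_sum fun i _ => ?_
        rw [abs_inner_blockFn_oseenKernel_eq hτ]
        exact hCW k l i
    _ = (∑ k, ∑ l, ∑ i, C k l i) * W := by
        rw [Finset.sum_mul]
        refine Finset.sum_congr rfl fun k _ => ?_
        rw [Finset.sum_mul]
        refine Finset.sum_congr rfl fun l _ => ?_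
        rw [Finset.sum_mul]
    _ = (∑ k, ∑ l, ∑ i, C k l i) * (2 : ℝ) ^ (((finrank ℝ E : ℤ) + 1) * j) *
          Real.exp (-(τ * 2 ^ (2 * j))) / (1 + (2 : ℝ) ^ j * ‖x‖) ^ n := by
        rw [hW]; ring

end Literature.Analysis.FluidPDE
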